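import Summits.BirchSwinnertonDyer.BirchSwinnertonDyer.Theses.SmallImageMuTransfer
import Summits.BirchSwinnertonDyer.BirchSwinnertonDyer.Theorems.SmallImageMuTransferMuTransferStubSurj
import Summits.BirchSwinnertonDyer.BirchSwinnertonDyer.Theorems.SmallImageMuTransferMuTransferStubCm
import Summits.BirchSwinnertonDyer.BirchSwinnertonDyer.Theorems.Rank1ResidualX9TwistedIm
import HarnessLib

/-!
# Glue item `MuTransferSplit` of route `SmallImageMuTransfer` (split D2 of crux `MuTransfer`, gen 1) — CLOSED here

`MuTransferSplit : MuTransferX9 → MuTransferInputs → MuTransfer` (items stmt-BirchSwinnertonDyer-19276 / 19277 /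
19629; glue item stmt-BirchSwinnertonDyer-19278).  Proof = the registered MuTransfer skeleton's case split
(surjective / CM / X9) with the two PUBLISHED cases discharged by the landed helpers
`Theorems.smallImageMuTransfer_stub_surj_of_kato_of_bcs` (p415185; Kato 2004 Thm 17.4 + BCS (a)) and
`Rank1Residual.smallImageMuTransfer_stub_cm_of_rubin_of_gv` (p417975; Rubin 1991 Thm 12.3 + Greenberg–Vatsal Thm 1.4
+ A25 + Carayol), all six published inputs read off `MuTransferInputs`; the X9 case is `MuTransferX9` verbatim.
Bookkeeping only: credits nothing toward the open child `MuTransferX9`.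

The import of `Theorems.Rank1ResidualX9TwistedIm` is deliberate (planner bsd-smallim-plan g4, tribunal T3): born-mode
tribunal probes import the landed `Theorems/SmallImageMuTransfer*` modules and nothing else problem-side, so this import
makes the route's registered BC5 witness `Rank1Residual.X9TwistedHypothesisIm_holds` visible to the kernel
(round 1 code `t3:witness-error` = unknown declaration); the witness is re-exported below under a route-local name.
-/

-- the summit and its single problem are both named `BirchSwinnertonDyer` (registry layout D-0017)
set_option linter.dupNamespace false

set_option autoImplicit false

namespace Summit.BirchSwinnertonDyer.BirchSwinnertonDyer.Theorems

/-- **BC5 witness of the route, re-exported** (so that it is visible wherever this module is): every X9 pair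
satisfies the twisted-image hypothesis (im), `Rank1Residual.X9TwistedHypothesisIm` — proved in
`Theorems/Rank1ResidualX9TwistedIm.lean` (p403477). [folklore] -/
theorem smallImageMuTransfer_bc5_witness :
    Summit.BirchSwinnertonDyer.BirchSwinnertonDyer.Rank1Residual.X9TwistedHypothesisIm :=
  Summit.BirchSwinnertonDyer.BirchSwinnertonDyer.Rank1Residual.X9TwistedHypothesisIm_holds

/-- **The glue item `MuTransferSplit`, literally the route decl.** -/
theorem smallImageMuTransfer_MuTransferSplit_proof :
    Summit.BirchSwinnertonDyer.BirchSwinnertonDyer.Theses.SmallImageMuTransfer.MuTransferSplit := by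
  unfold Summit.BirchSwinnertonDyer.BirchSwinnertonDyer.Theses.SmallImageMuTransfer.MuTransferSplit
  intro hX9 hIn
  obtain ⟨hKato, hBCS, hRu, hGV, h5, hlev⟩ := hIn
  unfold Summit.BirchSwinnertonDyer.BirchSwinnertonDyer.Theses.SmallImageMuTransfer.MuTransfer
    Summit.BirchSwinnertonDyer.BirchSwinnertonDyer.Rank1Residual.KatoMuTransfer
  intro W _ _ p _ N _ f hp hgood hord hirr hf hcert κ γ hκ hγ hγ' D
  by_cases hs : W.HasSurjectiveModNGaloisRep p
  · exact smallImageMuTransfer_stub_surj_of_kato_of_bcs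
      hKato hBCS W p f hp hgood hord hirr hs hf hcert κ γ hκ hγ hγ' D
  · by_cases hcm : W.HasCM
    · exact Summit.BirchSwinnertonDyer.BirchSwinnertonDyer.Rank1Residual.smallImageMuTransfer_stub_cm_of_rubin_of_gv
        hRu hGV h5 hlev W p f hp hgood hord hirr hs hcm hf hcert κ γ hκ hγ hγ' D
    · exact hX9 W p f ⟨hcm, hp, hgood, hord, hirr, hs⟩ hf hcert κ γ hκ hγ hγ' D

end Summit.BirchSwinnertonDyer.BirchSwinnertonDyer.Theorems
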